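import Literature.MathematicalPhysics.QuantumFieldTheory.OSEnvelopeBases
import Mathlib.Analysis.Convex.Topology
import Mathlib.Topology.ShrinkingLemma
import Mathlib.Analysis.Normed.Module.FiniteDimension
import HarnessLib

/-!
# Geometry of one continuation step of OS II: the base `c^{(N+1)} ∪ (generating set)` and its shrinkings

Topic `Literature/MathematicalPhysics/QuantumFieldTheory`; support file (all proved; two auxiliary
definitions `osPiece`, `stepBase`; no named facts) for the discharge of (A1)
`OS1975_exists_timeContinuation`. Osterwalder–Schrader II (Comm. Math. Phys. 42 (1975)), Ch. V.2,
(5.15), (5.23): at the step (A_N) ⇒ (A_{N+1}) the continued function lives on the tube over the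
union of the old base `c_k^{(N+1)}` (`osBaseC (N+1) k`) and of the generating set
(`osGen (osBaseD (N+1)) k`, the finite union over the position `p` of the free slot of the convex
**pieces** `osPiece (N+1) k p`), and Bochner's theorem carries it to the tube over the convex hull
`c_k^{(N+2)}`. This file records the (data-independent) geometry needed to run that step with
**explicit, family-uniform constants** (`BochnerExplicitBounds`):

* `osPiece`, `osGen_eq_iUnion_osPiece`, convexity / openness / `0 ∈` / cube bound of the pieces;
* `stepBase N k = osBaseC (N+1) k ∪ osGen (osBaseD (N+1)) k`: open, star-shaped with respect to
  `0`, inside the cube, with `convexHull ℝ (stepBase N k) = osBaseC (N+2) k`;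
* shrinkings: `smul_closure_subset_of_convex` (`t · closure P ⊆ P` for convex open `P ∋ 0`,
  `0 ≤ t < 1`), `smul_closure_stepBase_subset`, `isCompact_smul_closure_stepBase`, and the
  exhaustion `exists_lt_one_subset_smul_convexHull` (a compact subset of an open convex set
  containing `0` lies in `t · C` for some `t < 1`);
* `exists_compact_cover_stepBase` — a compact subset of `stepBase` is covered by compact subsets of
  the old base and of the pieces (shrinking lemma);
* `exists_abs_apply_le_of_isCompact` — on a compact subset of a piece the free argument stays
  `≤ θ₀ < π/2`, whence `Re ζ ≥ ‖ζ‖ cos θ₀` (`norm_mul_cos_le_re_of_abs_arg_le`).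

## References

* K. Osterwalder, R. Schrader, *Axioms for Euclidean Green's functions II*, Comm. Math. Phys. 42
  (1975) 281–305, Ch. V.2 (5.15), (5.22)–(5.23). [OsterwalderSchraderCMP1975]
-/

noncomputable section

open Set Metric
open scoped Pointwise Topology

namespace Literature.MathematicalPhysics.QuantumFieldTheory.OSEnvelope

variable {k : ℕ}

/-! ### The pieces of the generating set -/

/-- **The piece of the generating set with free slot at `p`**:
`{v | splitLeft v p ∈ d_p^{(N)}, |v_p| < π/2, splitRight v p ∈ d_{k-1-p}^{(N)}}` ((5.23) before the
hull, one position). [cite: OsterwalderSchraderCMP1975, Ch. V.2 eq. (5.23)] -/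
def osPiece (N k : ℕ) (p : Fin k) : Set (Fin k → ℝ) :=
  {v | splitLeft v p ∈ osBaseD N p ∧ |v p| < Real.pi / 2 ∧ splitRight v p ∈ osBaseD N (k - 1 - p)}

/-- The generating set is the union of its pieces. [cite: OsterwalderSchraderCMP1975, Ch. V.2 eq. (5.23)] -/
theorem osGen_eq_iUnion_osPiece (N k : ℕ) : osGen (osBaseD N) k = ⋃ p : Fin k, osPiece N k p := by
  ext v
  simp only [osGen, osPiece, mem_setOf_eq, mem_iUnion]

/-- The pieces are convex. [folklore] -/
theorem convex_osPiece (N k : ℕ) (p : Fin k) : Convex ℝ (osPiece N k p) :=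
  convex_osGen_piece (fun j => convex_osBaseD N j) p

/-- The pieces of level `N + 1` are open. [folklore] -/
theorem isOpen_osPiece_succ (N k : ℕ) (p : Fin k) : IsOpen (osPiece (N + 1) k p) := by
  have hset : osPiece (N + 1) k p = ((fun v => splitLeft v p) ⁻¹' osBaseD (N + 1) p ∩
      {v | |v p| < Real.pi / 2}) ∩ (fun v => splitRight v p) ⁻¹' osBaseD (N + 1) (k - 1 - p) := by
    ext v; simp only [osPiece, mem_setOf_eq, mem_inter_iff, mem_preimage, and_assoc]
  rw [hset]
  exact (((isOpen_osBaseD_succ N _).preimage (continuous_splitLeft p)).inter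
    (isOpen_lt ((continuous_apply p).abs) continuous_const)).inter
    ((isOpen_osBaseD_succ N _).preimage (continuous_splitRight p))

/-- `0` lies in every piece. [folklore] -/
theorem zero_mem_osPiece (N k : ℕ) (p : Fin k) : (0 : Fin k → ℝ) ∈ osPiece N k p :=
  zero_mem_osGen_piece N p

/-- The pieces lie in the generating set. [folklore] -/
theorem osPiece_subset_osGen (N k : ℕ) (p : Fin k) : osPiece N k p ⊆ osGen (osBaseD N) k :=
  fun _ hv => ⟨p, hv⟩

/-- The pieces lie in the next base `c_k^{(N+1)}`. [folklore] -/
theorem osPiece_subset_osBaseC_succ (N k : ℕ) (p : Fin k) : osPiece N k p ⊆ osBaseC (N + 1) k :=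
  (osPiece_subset_osGen N k p).trans (osGen_subset_osBaseC_succ N k)

/-- The pieces lie in the cube. [folklore] -/
theorem osPiece_subset_cube (N k : ℕ) (p : Fin k) : osPiece N k p ⊆ {v | ∀ i, |v i| < Real.pi / 2} :=
  (osPiece_subset_osGen N k p).trans (osGen_subset_cube N k)

/-! ### The base of one step -/

/-- **The base of the step (A_{N+1}) ⇒ (A_{N+2})**: the old base together with the generating set,
`stepBase N k = c_k^{(N+1)} ∪ gen(d^{(N+1)})_k`; its convex hull is `c_k^{(N+2)}`. [cite: OsterwalderSchraderCMP1975, Ch. V.2 (5.15), (5.23)] -/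
def stepBase (N k : ℕ) : Set (Fin k → ℝ) := osBaseC (N + 1) k ∪ osGen (osBaseD (N + 1)) k

/-- The base of the step is open. [folklore] -/
theorem isOpen_stepBase (N k : ℕ) : IsOpen (stepBase N k) :=
  (isOpen_osBaseC_succ N k).union (isOpen_osGen_osBaseD_succ N k)

/-- `0` lies in the base of the step (`k ≥ 1`). [folklore] -/
theorem zero_mem_stepBase (N : ℕ) (hk : 0 < k) : (0 : Fin k → ℝ) ∈ stepBase N k :=
  Or.inl (zero_mem_osBaseC _ hk)

/-- The base of the step is star-shaped with respect to `0`. [folklore] -/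
theorem starConvex_stepBase (N k : ℕ) : StarConvex ℝ (0 : Fin k → ℝ) (stepBase N k) := by
  rcases Nat.eq_zero_or_pos k with rfl | hk
  · intro y hy
    exact absurd hy (by
      rintro (h | ⟨p, -⟩)
      · rw [osBaseC_succ] at h
        have : osGen (osBaseD N) 0 = ∅ := by
          ext v; simp only [osGen, mem_setOf_eq, mem_empty_iff_false, iff_false]
          rintro ⟨p, -⟩; exact p.elim0
        rw [this, convexHull_empty] at h
        exact h
      · exact p.elim0)
  · exact ((isOSBaseFamily_osBase.convex (N + 1) k).starConvex (zero_mem_osBaseC _ hk)).union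
      (starConvex_osGen_osBaseD (N + 1) k)

/-- The base of the step lies in the cube. [folklore] -/
theorem stepBase_subset_cube (N k : ℕ) : stepBase N k ⊆ {v | ∀ i, |v i| < Real.pi / 2} :=
  union_subset (osBaseC_subset_cube _ _) (osGen_subset_cube _ _)

/-- The base of the step lies in the next base. [folklore] -/
theorem stepBase_subset_osBaseC (N k : ℕ) : stepBase N k ⊆ osBaseC (N + 2) k := by
  rcases Nat.eq_zero_or_pos k with rfl | hk
  · rintro v (h | ⟨p, -⟩)
    · exact absurd h (by
        rw [osBaseC_succ]
        have : osGen (osBaseD N) 0 = ∅ := by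
          ext v; simp only [osGen, mem_setOf_eq, mem_empty_iff_false, iff_false]
          rintro ⟨p, -⟩; exact p.elim0
        rw [this, convexHull_empty]; exact fun h => h)
    · exact p.elim0
  · exact union_subset (osBaseC_subset_succ (N + 1) hk) (osGen_subset_osBaseC_succ (N + 1) k)

/-- **The hull of the base of the step is the next base**:
`conv (c^{(N+1)} ∪ gen(d^{(N+1)})) = c^{(N+2)}`. [cite: OsterwalderSchraderCMP1975, Ch. V.2 (5.15), (5.23)] -/
theorem convexHull_stepBase (N k : ℕ) : convexHull ℝ (stepBase N k) = osBaseC (N + 2) k := by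
  refine Subset.antisymm (convexHull_min (stepBase_subset_osBaseC N k)
    (isOSBaseFamily_osBase.convex (N + 2) k)) ?_
  rw [show N + 2 = (N + 1) + 1 from rfl, osBaseC_succ]
  exact convexHull_mono subset_union_right

/-! ### Shrinkings -/

section Shrink

variable {E : Type*} [NormedAddCommGroup E] [NormedSpace ℝ E]

/-- **`t · closure P ⊆ P`** for a convex open `P ∋ 0` and `0 ≤ t < 1` (an interior point pulls the
closure inside). [folklore] -/
theorem smul_closure_subset_of_convex {P : Set E} (hPc : Convex ℝ P) (hPo : IsOpen P) (h0 : (0 : E) ∈ P)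
    {t : ℝ} (ht0 : 0 ≤ t) (ht1 : t < 1) : t • closure P ⊆ P := by
  rintro _ ⟨y, hy, rfl⟩
  have h := hPc.combo_interior_closure_mem_interior (by rwa [hPo.interior_eq]) hy
    (show 0 < 1 - t by linarith) ht0 (by ring)
  rw [hPo.interior_eq, smul_zero, zero_add] at h
  exact h

/-- For a convex set containing `0`, the dilates are monotone in the factor on `[0, ∞)`:
`s · C ⊆ t · C` for `0 ≤ s ≤ t`. [folklore] -/
theorem smul_set_subset_smul_set_of_le {C : Set E} (hC : Convex ℝ C) (h0 : (0 : E) ∈ C) {s t : ℝ}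
    (hs : 0 ≤ s) (hst : s ≤ t) : s • C ⊆ t • C := by
  rintro _ ⟨c, hc, rfl⟩
  rcases eq_or_lt_of_le hs with rfl | hs'
  · show (0 : ℝ) • c ∈ t • C
    rw [zero_smul]; exact ⟨0, h0, smul_zero _⟩
  · have ht : 0 < t := lt_of_lt_of_le hs' hst
    refine ⟨(s / t) • c, ?_, ?_⟩
    · have h1 : s / t ≤ 1 := (div_le_one ht).2 hst
      have := hC.starConvex h0
      have hmem := this hc (show 0 ≤ 1 - s / t by linarith) (div_nonneg hs ht.le) (by ring)
      simpa using hmem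
    · show t • ((s / t) • c) = s • c
      rw [smul_smul, mul_div_cancel₀ _ ht.ne']

/-- **Exhaustion of an open convex set containing `0` by its dilates**: a compact `K ⊆ C` lies in
`t · C` for some `t ∈ (0, 1)`. [folklore] -/
theorem exists_lt_one_subset_smul {C : Set E} (hCc : Convex ℝ C) (hCo : IsOpen C) (h0 : (0 : E) ∈ C)
    {K : Set E} (hK : IsCompact K) (hKC : K ⊆ C) : ∃ t : ℝ, 0 < t ∧ t < 1 ∧ K ⊆ t • C := by
  -- the open cover `U_n = (1 - 1/(n+2)) · C`
  set τ : ℕ → ℝ := fun n => 1 - 1 / ((n : ℝ) + 2) with hτ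
  have hτ0 : ∀ n, 0 < τ n := fun n => by
    simp only [hτ]
    have : (1 : ℝ) / ((n : ℝ) + 2) < 1 := by
      rw [div_lt_one (by positivity)]; linarith [n.cast_nonneg (α := ℝ)]
    linarith
  have hτ1 : ∀ n, τ n < 1 := fun n => by
    simp only [hτ]; have : (0 : ℝ) < 1 / ((n : ℝ) + 2) := by positivity
    linarith
  have hτmono : Monotone τ := fun a b hab => by
    simp only [hτ]
    have h1 : (0 : ℝ) < (a : ℝ) + 2 := by positivity
    have h2 : (a : ℝ) + 2 ≤ (b : ℝ) + 2 := by exact_mod_cast Nat.add_le_add_right hab 2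
    have := one_div_le_one_div_of_le h1 h2
    linarith
  have hcover : K ⊆ ⋃ n : ℕ, τ n • C := by
    intro y hy
    have hyC : y ∈ C := hKC hy
    -- `s ↦ s⁻¹ • y` is continuous at `1`, so `(τ n)⁻¹ • y ∈ C` for large `n`
    have hcont : Filter.Tendsto (fun s : ℝ => s⁻¹ • y) (𝓝 1) (𝓝 y) := by
      have h := ((continuousAt_inv₀ (one_ne_zero (α := ℝ))).smul (continuousAt_const (y := y)))
      have h' : Filter.Tendsto (fun s : ℝ => s⁻¹ • y) (𝓝 1) (𝓝 ((1 : ℝ)⁻¹ • y)) := h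
      rwa [inv_one, one_smul] at h'
    have hlim : Filter.Tendsto τ Filter.atTop (𝓝 1) := by
      have h1 : Filter.Tendsto (fun n : ℕ => (1 : ℝ) / ((n : ℝ) + 2)) Filter.atTop (𝓝 0) := by
        have := tendsto_one_div_add_atTop_nhds_zero_nat (𝕜 := ℝ)
        have h2 : Filter.Tendsto (fun n : ℕ => n + 1) Filter.atTop Filter.atTop := Filter.tendsto_add_atTop_nat 1
        have h3 := this.comp h2
        refine h3.congr fun n => ?_
        simp only [Function.comp_apply]; push_cast; ring_nf
      have : Filter.Tendsto (fun n : ℕ => 1 - (1 : ℝ) / ((n : ℝ) + 2)) Filter.atTop (𝓝 (1 - 0)) :=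
        tendsto_const_nhds.sub h1
      simpa [hτ] using this
    have hev := (hcont.comp hlim).eventually (hCo.mem_nhds hyC)
    obtain ⟨n, hn⟩ := hev.exists
    refine mem_iUnion.2 ⟨n, ?_⟩
    rw [Set.mem_smul_set_iff_inv_smul_mem₀ (hτ0 n).ne']
    exact hn
  obtain ⟨S, hS⟩ := hK.elim_finite_subcover (fun n => τ n • C)
    (fun n => hCo.smul₀ (hτ0 n).ne') hcover
  -- the largest index in the finite subcover
  set n₀ : ℕ := S.sup id with hn₀
  refine ⟨τ n₀, hτ0 n₀, hτ1 n₀, fun y hy => ?_⟩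
  obtain ⟨n, hn⟩ := mem_iUnion.1 (hS hy)
  obtain ⟨hnS, hyn⟩ := mem_iUnion.1 hn
  have hle : n ≤ n₀ := Finset.le_sup (f := id) hnS
  exact smul_set_subset_smul_set_of_le hCc h0 (hτ0 n).le (hτmono hle) hyn

end Shrink

/-- **Shrinkings of the base of the step stay inside it**: `t · closure (stepBase) ⊆ stepBase` for
`0 ≤ t < 1` (each piece and the old base are convex open and contain `0`). [folklore] -/
theorem smul_closure_stepBase_subset (N : ℕ) (hk : 0 < k) {t : ℝ} (ht0 : 0 ≤ t) (ht1 : t < 1) :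
    t • closure (stepBase N k) ⊆ stepBase N k := by
  rw [stepBase, osGen_eq_iUnion_osPiece, closure_union, closure_iUnion_of_finite, smul_set_union,
    smul_set_iUnion]
  refine union_subset_union ?_ (iUnion_mono fun p => ?_)
  · exact smul_closure_subset_of_convex (isOSBaseFamily_osBase.convex _ _) (isOpen_osBaseC_succ N k)
      (zero_mem_osBaseC _ hk) ht0 ht1
  · exact smul_closure_subset_of_convex (convex_osPiece _ _ p) (isOpen_osPiece_succ N k p)
      (zero_mem_osPiece _ _ p) ht0 ht1

/-- The shrunken closure of the base of the step is compact. [folklore] -/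
theorem isCompact_smul_closure_stepBase (N k : ℕ) (t : ℝ) : IsCompact (t • closure (stepBase N k)) := by
  have hbdd : Bornology.IsBounded (stepBase N k) := by
    rw [isBounded_iff_forall_norm_le]
    refine ⟨Real.pi / 2, fun v hv => ?_⟩
    rw [pi_norm_le_iff_of_nonneg (by positivity)]
    intro i
    rw [Real.norm_eq_abs]
    exact (stepBase_subset_cube N k hv i).le
  exact (hbdd.isCompact_closure).image (continuous_const_smul t)

/-- The shrunken base is open, star-shaped, contains `0`, and its hull is the shrunken next base. [folklore] -/
theorem smul_stepBase_props (N : ℕ) (hk : 0 < k) {t : ℝ} (ht0 : 0 < t) :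
    IsOpen (t • stepBase N k) ∧ (0 : Fin k → ℝ) ∈ t • stepBase N k ∧
      StarConvex ℝ (0 : Fin k → ℝ) (t • stepBase N k) ∧
      convexHull ℝ (t • stepBase N k) = t • osBaseC (N + 2) k := by
  refine ⟨(isOpen_stepBase N k).smul₀ ht0.ne', ⟨0, zero_mem_stepBase N hk, smul_zero _⟩, ?_, ?_⟩
  · have := (starConvex_stepBase N k).smul t
    rwa [smul_zero] at this
  · rw [convexHull_smul, convexHull_stepBase]

/-! ### Compact covers and margins -/

/-- **A compact subset of the base of the step is covered by compact subsets of the old base and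
of the pieces** (shrinking lemma for the finite open cover). [folklore] -/
theorem exists_compact_cover_stepBase (N k : ℕ) {K : Set (Fin k → ℝ)} (hK : IsCompact K)
    (hKB : K ⊆ stepBase N k) :
    ∃ (K₀ : Set (Fin k → ℝ)) (Kp : Fin k → Set (Fin k → ℝ)),
      IsCompact K₀ ∧ K₀ ⊆ osBaseC (N + 1) k ∧ (∀ p, IsCompact (Kp p)) ∧
      (∀ p, Kp p ⊆ osPiece (N + 1) k p) ∧ K ⊆ K₀ ∪ ⋃ p, Kp p := by
  classical
  -- the finite open cover indexed by `Option (Fin k)`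
  set u : Option (Fin k) → Set (Fin k → ℝ) := fun o => o.elim (osBaseC (N + 1) k) fun p => osPiece (N + 1) k p
    with hu
  have huo : ∀ o, IsOpen (u o) := by
    rintro (_ | p)
    · exact isOpen_osBaseC_succ N k
    · exact isOpen_osPiece_succ N k p
  have hus : K ⊆ ⋃ o, u o := by
    intro v hv
    rcases hKB hv with h | h
    · exact mem_iUnion.2 ⟨none, h⟩
    · rw [osGen_eq_iUnion_osPiece] at h
      obtain ⟨p, hp⟩ := mem_iUnion.1 h
      exact mem_iUnion.2 ⟨some p, hp⟩
  obtain ⟨v, hKv, hvc, hvu⟩ := exists_subset_iUnion_closed_subset hK.isClosed huo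
    (fun x _ => Set.toFinite _) hus
  refine ⟨K ∩ v none, fun p => K ∩ v (some p), hK.inter_right (hvc none),
    fun x hx => hvu none hx.2, fun p => hK.inter_right (hvc (some p)), fun p x hx => hvu (some p) hx.2,
    fun x hx => ?_⟩
  obtain ⟨o, ho⟩ := mem_iUnion.1 (hKv hx)
  rcases o with _ | p
  · exact Or.inl ⟨hx, ho⟩
  · exact Or.inr (mem_iUnion.2 ⟨p, hx, ho⟩)

/-- **On a compact subset of a piece the free argument stays away from `π/2`.** [folklore] -/
theorem exists_abs_apply_le_of_isCompact {N k : ℕ} {p : Fin k} {Kp : Set (Fin k → ℝ)}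
    (hKc : IsCompact Kp) (hKp : Kp ⊆ osPiece N k p) :
    ∃ θ₀ : ℝ, 0 ≤ θ₀ ∧ θ₀ < Real.pi / 2 ∧ ∀ v ∈ Kp, |v p| ≤ θ₀ := by
  rcases Kp.eq_empty_or_nonempty with rfl | hne
  · exact ⟨0, le_rfl, by positivity, fun v hv => absurd hv (notMem_empty _)⟩
  · obtain ⟨v₀, hv₀, hmax⟩ := hKc.exists_isMaxOn hne ((continuous_apply p).abs).continuousOn
    exact ⟨|v₀ p|, abs_nonneg _, (hKp hv₀).2.1, fun v hv => hmax hv⟩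

/-- **`Re ζ ≥ ‖ζ‖ cos θ₀`** when `|arg ζ| ≤ θ₀ ≤ π/2`. [folklore] -/
theorem norm_mul_cos_le_re_of_abs_arg_le {ζ : ℂ} {θ₀ : ℝ} (hθ : θ₀ ≤ Real.pi / 2)
    (h : |Complex.arg ζ| ≤ θ₀) : ‖ζ‖ * Real.cos θ₀ ≤ ζ.re := by
  rcases eq_or_ne ζ 0 with rfl | hζ
  · simp
  · have hcos : Real.cos θ₀ ≤ Real.cos (Complex.arg ζ) := by
      rw [← Real.cos_abs (Complex.arg ζ)]
      exact Real.cos_le_cos_of_nonneg_of_le_pi (abs_nonneg _) (by linarith [Real.pi_pos]) h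
    have hre : ζ.re = ‖ζ‖ * Real.cos (Complex.arg ζ) := by
      rw [Complex.cos_arg hζ]; field_simp
    rw [hre]
    exact mul_le_mul_of_nonneg_left hcos (norm_nonneg _)

end Literature.MathematicalPhysics.QuantumFieldTheory.OSEnvelope
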